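import Literature.AlgebraicGeometry.Limits.LocalizationSchemeDescent
import Literature.AlgebraicGeometry.Limits.LocalizationProdLimit
import Literature.AlgebraicGeometry.Limits.StageRestriction
import Literature.AlgebraicGeometry.Limits.LocalizationOpenDescent
import Literature.AlgebraicGeometry.GroupActions.FixedPointSchemeFinitePresentation
import HarnessLib

/-!
# Limits of schemes: schemes of finite presentation over `P ×_A Spec A_S` come from a stage `P ×_A Spec A[1/t]`
# (EGA IV₃ Thm. 8.8.2 (ii) and (i) RELATIVE to a quasi-compact quasi-separated base `P` of finite presentation)

Topic `Literature/AlgebraicGeometry/Limits`; namespace `Literature.AlgebraicGeometry.Limits.LocApprox` (the series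
`LocalizationDiagram` … `LocalizationSchemeDescent`, `LocalizationProdLimit`, `StageRestriction`).  THEOREMS ONLY (no definition, no
named fact, no instance, no notation, no `sorry`; net Literature debt 0).  Cell `hodgecm-mathlib` (D-0151), programme F0∕P6 «MOD»,
SPREAD door (LEAD M-17m), organ **(SP1-a)** of the census «abelian-scheme spread over a LocApprox stage» (LEAD F0P6-plan (g2)
2026-09-01 20:42:56Z); `--supports stmt-HodgeConjecture-24832`, count-neutral.  HONEST LABEL: HC_CM is proved only modulo the 2
remaining named inputs (hLiu418 24832, h413 24833) until rung 0 closes; this file discharges none of them and is general scheme theory.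

## Setting and statements

`A` a commutative ring, `S ⊆ A` a submonoid, `B = A_S` (`IsLocalization S B`), `Spec B = lim_t Spec A[1/t]` the cofiltered limit of
the basic open stages `D(t) = (baseDiagram S).obj t`, `t : Idx S` (★ `LocalizationDiagram`, legs `leg S B t = (baseCone S B).π.app t`),
and `P → Spec A` quasi-compact, quasi-separated and locally of finite presentation, so that `P ⊗ Spec B = lim_t P ⊗ D(t)`
(★ `isLimitProdCone`).  The ★ spreading-out library is ABSOLUTE (schemes and morphisms over the stages `D(t)`); this file is the
RELATIVE form over the non-affine base `P`, in the tensor∕stage currency of ★ `StageRestriction` (a MODEL OVER THE STAGE `t` is an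
`A`-scheme `Y` with a `D(t)`-morphism `h : Y ⊗ D(t) → P ⊗ D(t)`, restricted to finer stages by ★ `res`, with GENERIC VALUE
`h_B : Y ⊗ Spec B → P ⊗ Spec B`, `(Y ◁ leg_t) ≫ h = h_B ≫ (P ◁ leg_t)`):

* §1 `isPullback_whiskerLeft_left_of_comp_eq` — the dictionary: for `g : T' → T` and `D`-morphisms `h` over `T`, `h'` over `T'` with
  `(Y ◁ g) ≫ h = h' ≫ (P ◁ g)`, the square of total spaces is CARTESIAN (`Y ⊗ T' = (Y ⊗ T) ×_{P ⊗ T} (P ⊗ T')`); instances: the generic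
  value (`g = leg S B t`) and the restriction `res ρ h` (`g = (baseDiagram S).map ρ`).
* §2 `exists_stage_model` — **EGA IV₃ 8.8.2 (ii) relative to `P`**: every quasi-compact quasi-separated `X → P ⊗ Spec B` locally of
  finite presentation is, over `P ⊗ Spec B`, the generic value of a model `(Y, h)` over some stage `t`.  KEY REDUCTION (no gluing):
  `X → P ⊗ Spec B → Spec B` is quasi-compact, quasi-separated and locally of finite presentation, so ★ `exists_iso_pullback`
  (8.8.2 (ii) absolute) gives `Y` with `Y ⊗ Spec B ≅ X`; the structure map is then an `A`-morphism `Y ⊗ Spec B → P` and spreads to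
  `Y ⊗ D(t) → P` by ★ `exists_whiskerLeft_comp_eq` (8.8.2 (i) absolute), paired with the projection (★ `overStage`).
* §3 `exists_stage_isPullback` — the same in the `Over`∕`IsPullback` currency: `∃ t (Y : Over (P ⊗ D(t)).left) (G : X.left ⟶ Y.left)`,
  `Y.hom` quasi-compact, quasi-separated, locally of finite presentation, `IsPullback G X.hom Y.hom (P ◁ leg_t).left`.
* §4 `exists_stage_res_eq_res`, `exists_stage_hom_over` — **EGA IV₃ 8.8.2 (i) relative to `P`**: `D(t)`-morphisms between stage models
  agreeing generically agree at a finer stage; a `P ⊗ Spec B`-morphism between the generic values of two stage models comes from a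
  `P ⊗ D(s)`-morphism between their restrictions to a finer stage `s`.

## References

* [EGAIV3] A. Grothendieck, J. Dieudonné, EGA IV₃ (Publ. Math. IHÉS 28, 1966), Thm. 8.8.2 (i), (ii), p. 28–31.
* [StacksProject] The Stacks project, Tags 01ZM (Lemma 32.10.1), 01ZC (Prop. 32.6.1).
* [GortzWedhorn2020] U. Görtz, T. Wedhorn, *Algebraic Geometry I: Schemes*, 2nd ed. (2020), Thm. 10.63, Cor. 10.64, Thm. 10.66
  (pp. 328–330).
-/

set_option autoImplicit false

noncomputable section

universe u

open CategoryTheory CategoryTheory.Limits AlgebraicGeometry MonoidalCategory CartesianMonoidalCategory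

namespace Literature.AlgebraicGeometry.Limits

namespace LocApprox

open Literature.AlgebraicGeometry.Motives (SchemeOver specOver)

set_option backward.isDefEq.respectTransparency false

variable {A : Type u} [CommRing A]

/-! ## §1 The dictionary: squares of total spaces over a base change of the stage are cartesian -/

section Dictionary

variable {Y P T' T : SchemeOver A}

/-- **`Y ⊗ T' = (Y ⊗ T) ×_{P ⊗ T} (P ⊗ T')` on total spaces.**  For `g : T' → T`, a `T`-morphism `h : Y ⊗ T → P ⊗ T` and a
`T'`-morphism `h' : Y ⊗ T' → P ⊗ T'` with `(Y ◁ g) ≫ h = h' ≫ (P ◁ g)`, the square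
`(Y ◁ g).left, h'.left ∕ h.left, (P ◁ g).left` is cartesian: both `Y ⊗ T' → Y ⊗ T` and `P ⊗ T' → P ⊗ T` are base changes of
`g` (★ `SubalgApprox.isPullback_whiskerLeft_left`), and a square between two cartesian squares over the same base map is cartesian
(Mathlib `IsPullback.of_right`).  [cite: GortzWedhorn2020, Section (4.15) (p. 116), transitivity of fibre products]
[cite: EGAIV3, Thm. 8.8.2, setting (8.8.1)] -/
theorem isPullback_whiskerLeft_left_of_comp_eq (g : T' ⟶ T) (h : Y ⊗ T ⟶ P ⊗ T) (hh : h ≫ snd P T = snd Y T)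
    (h' : Y ⊗ T' ⟶ P ⊗ T') (hh' : h' ≫ snd P T' = snd Y T') (hc : (Y ◁ g) ≫ h = h' ≫ (P ◁ g)) :
    IsPullback (Y ◁ g).left h'.left h.left (P ◁ g).left := by
  have hh₁ : h.left ≫ pullback.snd P.hom T.hom = pullback.snd Y.hom T.hom := congrArg CommaMorphism.left hh
  have hh₁' : h'.left ≫ pullback.snd P.hom T'.hom = pullback.snd Y.hom T'.hom :=
    congrArg CommaMorphism.left hh'
  refine IsPullback.of_bot ?_ (congrArg CommaMorphism.left hc) (SubalgApprox.isPullback_whiskerLeft_left P g)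
  rw [hh₁, hh₁']
  exact SubalgApprox.isPullback_whiskerLeft_left Y g

variable {S : Submonoid A}

/-- **The restriction square is cartesian**: for a `D(t)`-morphism `h : Y ⊗ D(t) → P ⊗ D(t)` and a finer stage `ρ : s ⟶ t`,
`Y ⊗ D(s) = (Y ⊗ D(t)) ×_{P ⊗ D(t)} (P ⊗ D(s))` via ★ `res ρ h` (`res_comp_whiskerLeft`).
[cite: GortzWedhorn2020, Thm. 10.63 and Cor. 10.64 (pp. 328–329)] -/
theorem isPullback_whiskerLeft_map_left_res {t s : Idx S} (ρ : s ⟶ t)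
    (h : Y ⊗ (baseDiagram S).obj t ⟶ P ⊗ (baseDiagram S).obj t) (hh : h ≫ snd _ _ = snd _ _) :
    IsPullback (Y ◁ (baseDiagram S).map ρ).left (res ρ h).left h.left (P ◁ (baseDiagram S).map ρ).left :=
  isPullback_whiskerLeft_left_of_comp_eq _ h hh _ (res_snd ρ h) (res_comp_whiskerLeft ρ h hh).symm

variable {B : Type u} [CommRing B] [Algebra A B] [IsLocalization S B]

/-- **The generic-value square is cartesian**: for a `D(t)`-morphism `h : Y ⊗ D(t) → P ⊗ D(t)` with generic value
`h_B : Y ⊗ Spec B → P ⊗ Spec B` (`(Y ◁ leg_t) ≫ h = h_B ≫ (P ◁ leg_t)`), `Y ⊗ Spec B = (Y ⊗ D(t)) ×_{P ⊗ D(t)} (P ⊗ Spec B)`.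
[cite: GortzWedhorn2020, Thm. 10.63 (p. 328)] [cite: EGAIV3, Thm. 8.8.2, setting (8.8.1)] -/
theorem isPullback_whiskerLeft_leg_left {t : Idx S} (h : Y ⊗ (baseDiagram S).obj t ⟶ P ⊗ (baseDiagram S).obj t)
    (hh : h ≫ snd _ _ = snd _ _) (hB : Y ⊗ specOver A B ⟶ P ⊗ specOver A B) (hhB : hB ≫ snd _ _ = snd _ _)
    (hc : (Y ◁ leg S B t) ≫ h = hB ≫ (P ◁ leg S B t)) :
    IsPullback (Y ◁ leg S B t).left hB.left h.left (P ◁ leg S B t).left :=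
  isPullback_whiskerLeft_left_of_comp_eq _ h hh hB hhB hc

end Dictionary

/-! ## §2 EGA IV₃ 8.8.2 (ii) relative to `P`: schemes of finite presentation over `P ⊗ Spec B` come from a stage -/

section Model

variable (S : Submonoid A) {B : Type u} [CommRing B] [Algebra A B] [IsLocalization S B]
variable {P : SchemeOver A} [QuasiCompact P.hom] [QuasiSeparated P.hom] [LocallyOfFinitePresentation P.hom]

/-- **EGA IV₃ 8.8.2 (ii) relative to a quasi-compact quasi-separated base `P` locally of finite presentation.**  Let
`X → P ⊗ Spec B` (`B = A_S`) be quasi-compact, quasi-separated and locally of finite presentation.  Then there are an `A`-scheme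
`Y → Spec A`, quasi-compact, quasi-separated and locally of finite presentation, a stage `t`, a `D(t)`-morphism
`h : Y ⊗ D(t) → P ⊗ D(t)` and its generic value `h_B : Y ⊗ Spec B → P ⊗ Spec B` (`(Y ◁ leg_t) ≫ h = h_B ≫ (P ◁ leg_t)`), and an
isomorphism `Y ⊗ Spec B ≅ X` OVER `P ⊗ Spec B` (`e.hom ≫ X.hom = h_B.left`).  Proof: `X → P ⊗ Spec B → Spec B` is quasi-compact,
quasi-separated and locally of finite presentation, so ★ `exists_iso_pullback` (8.8.2 (ii) for `Spec B = lim D(t)`) gives `Y` and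
`Y ⊗ Spec B ≅ X` over `Spec B`; the structure map becomes an `A`-morphism `Y ⊗ Spec B → P`, which factors through a stage by ★
`exists_whiskerLeft_comp_eq` (8.8.2 (i), `Y` quasi-compact quasi-separated, `P` locally of finite presentation); pair it with the
projection (★ `overStage`, `whiskerLeft_π_overStage`).  [cite: EGAIV3, Thm. 8.8.2 (ii), p. 28] [cite: StacksProject, Tag 01ZM]
[cite: GortzWedhorn2020, Thm. 10.66 (p. 330)] -/
theorem exists_stage_model (X : Over (P ⊗ specOver A B).left) [QuasiCompact X.hom] [QuasiSeparated X.hom]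
    [LocallyOfFinitePresentation X.hom] :
    ∃ (Y : SchemeOver A) (_ : QuasiCompact Y.hom) (_ : QuasiSeparated Y.hom) (_ : LocallyOfFinitePresentation Y.hom)
      (t : Idx S) (h : Y ⊗ (baseDiagram S).obj t ⟶ P ⊗ (baseDiagram S).obj t)
      (hB : Y ⊗ specOver A B ⟶ P ⊗ specOver A B) (e : (Y ⊗ specOver A B).left ≅ X.left),
      h ≫ snd _ _ = snd _ _ ∧ hB ≫ snd _ _ = snd _ _ ∧ (Y ◁ leg S B t) ≫ h = hB ≫ (P ◁ leg S B t) ∧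
        e.hom ≫ X.hom = hB.left := by
  -- `X` as a `B`-scheme: quasi-compact, quasi-separated, locally of finite presentation over `Spec B`
  let XB : SchemeOver B := Over.mk (X.hom ≫ (snd P (specOver A B)).left)
  haveI : QuasiCompact XB.hom :=
    inferInstanceAs (QuasiCompact (X.hom ≫ pullback.snd P.hom (specOver A B).hom))
  haveI : QuasiSeparated XB.hom :=
    inferInstanceAs (QuasiSeparated (X.hom ≫ pullback.snd P.hom (specOver A B).hom))
  haveI : LocallyOfFinitePresentation XB.hom :=
    inferInstanceAs (LocallyOfFinitePresentation (X.hom ≫ pullback.snd P.hom (specOver A B).hom))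
  -- 8.8.2 (ii) absolute: a model `Y` of the total space
  obtain ⟨Y, hqc, hqs, hlfp, ⟨ε⟩⟩ := exists_iso_pullback S XB
  have hε : ε.hom.left ≫ X.hom ≫ pullback.snd P.hom (specOver A B).hom =
      pullback.snd Y.hom (specOver A B).hom := Over.w ε.hom
  let e : (Y ⊗ specOver A B).left ≅ X.left := (Over.forget _).mapIso ε
  have he : e.hom = ε.hom.left := rfl
  -- the structure map over `Spec B`, as an `A`-morphism `Y ⊗ Spec B ⟶ P ⊗ Spec B`
  let hB : Y ⊗ specOver A B ⟶ P ⊗ specOver A B := Over.homMk (e.hom ≫ X.hom) (by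
    change (ε.hom.left ≫ X.hom) ≫ (P ⊗ specOver A B).hom = (Y ⊗ specOver A B).hom
    rw [← Over.w (snd P (specOver A B)), Over.snd_left, Category.assoc, reassoc_of% hε,
      ← Over.w (snd Y (specOver A B)), Over.snd_left])
  have hhB : hB ≫ snd _ _ = snd _ _ := by
    ext : 1
    change (e.hom ≫ X.hom) ≫ (snd P (specOver A B)).left = (snd Y (specOver A B)).left
    rw [Over.snd_left, Over.snd_left, he, Category.assoc, hε]
  -- 8.8.2 (i) absolute: the first component spreads to a stage; pair it with the projection
  obtain ⟨t, g, hg⟩ :=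
    exists_whiskerLeft_comp_eq B (S := S) (P := Y) (X := P) (hB ≫ fst P (specOver A B))
  exact ⟨Y, hqc, hqs, hlfp, t, overStage g, hB, e, overStage_snd g, hhB,
    whiskerLeft_π_overStage (B := B) g hB hhB hg, rfl⟩

end Model

/-! ## §3 The `Over` ∕ `IsPullback` currency -/

section OverCurrency

variable (S : Submonoid A) {B : Type u} [CommRing B] [Algebra A B] [IsLocalization S B]
variable {P : SchemeOver A} [QuasiCompact P.hom] [QuasiSeparated P.hom] [LocallyOfFinitePresentation P.hom]

/-- **EGA IV₃ 8.8.2 (ii) relative to `P`, `IsPullback` form.**  A quasi-compact quasi-separated `X → P ⊗ Spec B` locally of finite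
presentation is the base change, along the leg `(P ◁ leg_t).left : (P ⊗ Spec B).left → (P ⊗ D(t)).left`, of a quasi-compact
quasi-separated `Y → (P ⊗ D(t)).left` locally of finite presentation, for some stage `t` (`exists_stage_model` + §1; the three
finiteness properties of `Y = (h.left : (Y₀ ⊗ D(t)).left → (P ⊗ D(t)).left)` by cancellation against `P ⊗ D(t) → D(t)`, which is
quasi-separated and locally of finite type).  [cite: EGAIV3, Thm. 8.8.2 (ii), p. 28] [cite: StacksProject, Tag 01ZM]
[cite: GortzWedhorn2020, Thm. 10.66 (p. 330)] -/
theorem exists_stage_isPullback (X : Over (P ⊗ specOver A B).left) [QuasiCompact X.hom] [QuasiSeparated X.hom]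
    [LocallyOfFinitePresentation X.hom] :
    ∃ (t : Idx S) (Y : Over (P ⊗ (baseDiagram S).obj t).left) (G : X.left ⟶ Y.left),
      QuasiCompact Y.hom ∧ QuasiSeparated Y.hom ∧ LocallyOfFinitePresentation Y.hom ∧
        IsPullback G X.hom Y.hom (P ◁ (baseCone S B).π.app t).left := by
  obtain ⟨Y, _, _, _, t, h, hB, e, hh, hhB, hc, he⟩ := exists_stage_model S X
  have hh₁ : h.left ≫ pullback.snd P.hom ((baseDiagram S).obj t).hom =
      pullback.snd Y.hom ((baseDiagram S).obj t).hom := congrArg CommaMorphism.left hh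
  refine ⟨t, Over.mk h.left, e.inv ≫ (Y ◁ leg S B t).left, ?_, ?_, ?_, ?_⟩
  · change QuasiCompact h.left
    haveI : QuasiCompact (h.left ≫ pullback.snd P.hom ((baseDiagram S).obj t).hom) := by
      rw [hh₁]; infer_instance
    exact QuasiCompact.of_comp h.left (pullback.snd P.hom ((baseDiagram S).obj t).hom)
  · change QuasiSeparated h.left
    haveI : QuasiSeparated (h.left ≫ pullback.snd P.hom ((baseDiagram S).obj t).hom) := by
      rw [hh₁]; infer_instance
    exact QuasiSeparated.of_comp h.left (pullback.snd P.hom ((baseDiagram S).obj t).hom)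
  · change LocallyOfFinitePresentation h.left
    haveI : LocallyOfFinitePresentation (h.left ≫ pullback.snd P.hom ((baseDiagram S).obj t).hom) := by
      rw [hh₁]; infer_instance
    exact Literature.AlgebraicGeometry.GroupActions.locallyOfFinitePresentation_of_comp h.left
      (pullback.snd P.hom ((baseDiagram S).obj t).hom)
  · have hX : X.hom = e.inv ≫ hB.left := by rw [← he, Iso.inv_hom_id_assoc]
    have sq : IsPullback e.inv X.hom hB.left (𝟙 _) :=
      IsPullback.of_horiz_isIso ⟨by rw [hX, Category.comp_id]⟩
    change IsPullback (e.inv ≫ (Y ◁ leg S B t).left) X.hom h.left (P ◁ leg S B t).left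
    simpa only [Category.id_comp] using sq.paste_horiz (isPullback_whiskerLeft_leg_left h hh hB hhB hc)

end OverCurrency

/-! ## §4 EGA IV₃ 8.8.2 (i) relative to `P`: morphisms over a stage -/

section Hom

variable {S : Submonoid A} {B : Type u} [CommRing B] [Algebra A B] [IsLocalization S B]
variable {P Y Z : SchemeOver A}

/-- **Restriction in two steps is restriction in one** (`res σ (res ρ φ) = res (σ ≫ ρ) φ` for `φ` over its stage): transitivity
of base change along `D(r) ⊆ D(s) ⊆ D(t)`, by the defining squares ★ `res_comp_whiskerLeft` and the monomorphism
`P₂ ⊗ D(r) → P₂ ⊗ D(t)`.  [cite: GortzWedhorn2020, Thm. 10.63 (p. 328)] -/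
theorem res_res {P₁ P₂ : SchemeOver A} {r s t : Idx S} (σ : r ⟶ s) (ρ : s ⟶ t)
    (φ : P₁ ⊗ (baseDiagram S).obj t ⟶ P₂ ⊗ (baseDiagram S).obj t) (hφ : φ ≫ snd _ _ = snd _ _) :
    res σ (res ρ φ) = res (σ ≫ ρ) φ := by
  rw [← cancel_mono (P₂ ◁ (baseDiagram S).map (σ ≫ ρ)), res_comp_whiskerLeft (σ ≫ ρ) φ hφ, Functor.map_comp,
    MonoidalCategory.whiskerLeft_comp, MonoidalCategory.whiskerLeft_comp,
    res_comp_whiskerLeft_assoc σ _ (res_snd ρ φ), res_comp_whiskerLeft ρ φ hφ, Category.assoc]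

/-- **Uniqueness at a finer stage.**  Two `A`-morphisms `g₁, g₂ : Y ⊗ D(t) → Z ⊗ D(t)` (`Y` quasi-compact, `Z` locally of finite type
over `A`) which agree on `Y ⊗ Spec B` agree after restriction (★ `res`) to some finer stage `s` (★ `exists_whiskerLeft_map_comp_eq` on
the first components).  [cite: EGAIV3, Thm. 8.8.2 (i), p. 28] [cite: StacksProject, Tag 01ZC]
[cite: GortzWedhorn2020, Thm. 10.63 (p. 328)] -/
theorem exists_stage_res_eq_res [QuasiCompact Y.hom] [LocallyOfFiniteType Z.hom] {t : Idx S}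
    (g₁ g₂ : Y ⊗ (baseDiagram S).obj t ⟶ Z ⊗ (baseDiagram S).obj t)
    (hgen : (Y ◁ leg S B t) ≫ g₁ = (Y ◁ leg S B t) ≫ g₂) :
    ∃ (s : Idx S) (ρ : s ⟶ t), res ρ g₁ = res ρ g₂ := by
  obtain ⟨s, ρ, e⟩ := exists_whiskerLeft_map_comp_eq B (S := S) (P := Y) (X := Z)
    (g₁ ≫ fst Z ((baseDiagram S).obj t)) (g₂ ≫ fst Z ((baseDiagram S).obj t))
    (by rw [reassoc_of% hgen])
  refine ⟨s, ρ, ?_⟩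
  change overStage ((Y ◁ (baseDiagram S).map ρ) ≫ g₁ ≫ fst _ _) =
    overStage ((Y ◁ (baseDiagram S).map ρ) ≫ g₂ ≫ fst _ _)
  rw [e]

/-- **EGA IV₃ 8.8.2 (i) relative to `P`: morphisms between generic values of stage models come from a finer stage.**  Let
`(Y, h_Y)` and `(Z, h_Z)` be models over the stage `t` (`D(t)`-morphisms to `P ⊗ D(t)`; `Y` quasi-compact and quasi-separated, `Z`
locally of finite presentation and `P` locally of finite type over `A`) with generic values `h_{Y,B}`, `h_{Z,B}`, and let
`f : Y ⊗ Spec B → Z ⊗ Spec B` be a morphism OVER `P ⊗ Spec B` (`f ≫ h_{Z,B} = h_{Y,B}`).  Then for some finer stage `ρ : s ⟶ t`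
there is a morphism `g : Y ⊗ D(s) → Z ⊗ D(s)` OVER `P ⊗ D(s)` (`g ≫ res ρ h_Z = res ρ h_Y`) with generic value `f`
(`(Y ◁ leg_s) ≫ g = f ≫ (Z ◁ leg_s)`): existence by ★ `exists_whiskerLeft_comp_eq` (8.8.2 (i) absolute) and ★ `overStage`, the
equation over `P` by `exists_stage_res_eq_res`.  [cite: EGAIV3, Thm. 8.8.2 (i), p. 28] [cite: StacksProject, Tag 01ZC]
[cite: GortzWedhorn2020, Thm. 10.63 and Cor. 10.64 (pp. 328–329)] -/
theorem exists_stage_hom_over [QuasiCompact Y.hom] [QuasiSeparated Y.hom] [LocallyOfFinitePresentation Z.hom]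
    [LocallyOfFiniteType P.hom] {t : Idx S}
    (hY : Y ⊗ (baseDiagram S).obj t ⟶ P ⊗ (baseDiagram S).obj t) (hhY : hY ≫ snd _ _ = snd _ _)
    (hZ : Z ⊗ (baseDiagram S).obj t ⟶ P ⊗ (baseDiagram S).obj t) (hhZ : hZ ≫ snd _ _ = snd _ _)
    (hYB : Y ⊗ specOver A B ⟶ P ⊗ specOver A B) (hcY : (Y ◁ leg S B t) ≫ hY = hYB ≫ (P ◁ leg S B t))
    (hZB : Z ⊗ specOver A B ⟶ P ⊗ specOver A B) (hcZ : (Z ◁ leg S B t) ≫ hZ = hZB ≫ (P ◁ leg S B t))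
    (f : Y ⊗ specOver A B ⟶ Z ⊗ specOver A B) (hf : f ≫ snd _ _ = snd _ _) (hfP : f ≫ hZB = hYB) :
    ∃ (s : Idx S) (ρ : s ⟶ t) (g : Y ⊗ (baseDiagram S).obj s ⟶ Z ⊗ (baseDiagram S).obj s),
      g ≫ snd _ _ = snd _ _ ∧ g ≫ res ρ hZ = res ρ hY ∧ (Y ◁ leg S B s) ≫ g = f ≫ (Z ◁ leg S B s) := by
  -- 8.8.2 (i) absolute on the first component of `f`, then a common refinement of its stage and `t`
  obtain ⟨s₁, g₁, hg₁⟩ :=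
    exists_whiskerLeft_comp_eq B (S := S) (P := Y) (X := Z) (f ≫ fst Z (specOver A B))
  obtain ⟨s₂, ⟨ρ₁⟩, ⟨ρ₂⟩⟩ := exists_hom₂ S s₁ t
  -- `g₂ = overStage (resStage ρ₁ g₁)` is over `D(s₂)` with generic value `f`
  have hg₂ : (Y ◁ leg S B s₂) ≫ overStage (resStage ρ₁ g₁) = f ≫ (Z ◁ leg S B s₂) :=
    whiskerLeft_π_overStage (B := B) _ f hf (by
      rw [resStage, ← MonoidalCategory.whiskerLeft_comp_assoc, leg_comp_map, hg₁])
  -- the two `D(s₂)`-morphisms `Y ⊗ D(s₂) → P ⊗ D(s₂)` agree generically, hence at a finer stage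
  have ha : (Y ◁ leg S B s₂) ≫ (overStage (resStage ρ₁ g₁) ≫ res ρ₂ hZ) = (Y ◁ leg S B s₂) ≫ res ρ₂ hY := by
    rw [reassoc_of% hg₂, whiskerLeft_leg_comp_res ρ₂ (B := B) hZ hhZ hZB hcZ, ← Category.assoc, hfP,
      whiskerLeft_leg_comp_res ρ₂ (B := B) hY hhY hYB hcY]
  obtain ⟨s, ρ₃, e⟩ := exists_stage_res_eq_res _ _ ha
  refine ⟨s, ρ₃ ≫ ρ₂, res ρ₃ (overStage (resStage ρ₁ g₁)), res_snd _ _, ?_, ?_⟩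
  · rw [← res_res ρ₃ ρ₂ hZ hhZ, ← res_res ρ₃ ρ₂ hY hhY, ← res_comp ρ₃ _ _ (overStage_snd _) (res_snd ρ₂ hZ), e]
  · exact whiskerLeft_leg_comp_res ρ₃ (B := B) _ (overStage_snd _) f hg₂

end Hom

end LocApprox

end Literature.AlgebraicGeometry.Limits

end
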